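import Literature.Combinatorics.Sahi2008.Indicators
import Summits.CriticalPhenomena.PercolationContinuityZ3.Theorems.PercNearOneGluingNoHeavyLowerTailSahiSlotCycleWeights
import Summits.CriticalPhenomena.PercolationContinuityZ3.Theorems.PercNearOneGluingNoHeavyLowerTailSahiSlotPatternLink

/-!
# The slot-pattern kernel with a pinned slot, II: the TOP-CELL IDENTITY, nonnegativity and MONOTONICITY OF THE CHARGE on the meet —
# every order `n ≥ 2`, every dimension `d`

Support file of the one-cut programme (crux `NoHeavyLowerTail`, stmt-CriticalPhenomena-4575; cell `prim-masterthm`, seat P3, gen 29;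
`run/shared/lean/prim/prim-masterthm/prim-masterthm-p3/HIERARCHY.md` §36).  Answer to prim-master-conj gen 46 (memo
`prim-l12/FROM-prim-master-conj-g46-CHARGE-MONOTONICITY.md` §5: "charge monotonicity at every order — paper; orders ≥ 5 need the general-`n` kernel").

The general-`n` kernel is `SahiSlot.patternForm d n` (gen 18; `(n!)^d · E_n^{⊗g}(f) = Σ_r w(r) · patternForm(f ∘ slot_r)`).  PIN slot `0` at a point `m` of
the slot cube `[N+2]^d` and put indicators of sets `a_0,…,a_N` on the other slots: the value
  `patternForm d (N+2) (𝟙_{m}, 𝟙_{a_0}, …, 𝟙_{a_N})`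
is the ORDER-`(N+2)` CHARGE of the family `a` at `m` — the coefficient of `[m ∈ a₋₁]` in the kernel (`patternForm_cons_setInd_eq_sum_pinned`, first-point form).
* **`pinned_eq_topCell`** (TOP-CELL IDENTITY): for `m ∈ ⋂_i a_i`,
  `charge(m) = Σ_{τ' ∈ S_{N+1}^d} Σ_{ρ ∈ S_{N+1}} Π_{c ∈ cycles ρ} (1 − Π_{i ∈ c} [ι_m(p_{min c}) ∈ a_i])`,
  where `p_j = τ'·diag j` are the points of the Latin `(N+1)`-tuple of the LINK `[N+1]^d` and `ι_m(q) = (m_a.succAbove q_a)_a` embeds the link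
  (link reduction + the pointwise Lieb–Sahi insertion recursion `…SahiSlotPatternLink`, then the cycle-weight identity `…SahiSlotCycleWeights`);
* **`pinned_nonneg_of_mem`** (Lemma R at every order): the charge is `≥ 0` at every point of the meet — for ARBITRARY sets `a_i`;
* **`pinned_mono_of_mem`** (CHARGE MONOTONICITY at every order): for up-sets `a_i`, `m ≤ m'`, `m ∈ ⋂ a_i` ⟹ `charge(m) ≤ charge(m')`
  (raising `m` lowers `ι_m` coordinatewise — `succAbove_anti_left` — so the pulled-back traces of up-sets shrink and every factor `1 − Π[…]` grows).
Orders 3 and 4 in the `ι → Fin 3 / Fin 4` Latin vocabulary are prim-master-conj's `SahiLatin.Phi_mono_of_mem_inter` / `Phi4_mono_of_mem_inter`.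
HONEST LABEL: structure theorems about the kernel; nothing here asserts `SlotPatternPos d n` (Sahi positivity) for any `n ≥ 3`.
No definitions; everything proved; axioms standard. [this work]
-/

noncomputable section

namespace Summit.CriticalPhenomena.PercolationContinuityZ3.Theorems

open Finset Function Equiv Equiv.Perm
open Literature.Combinatorics.Sahi2008 Literature.Combinatorics.Sahi2008.CycleForm

namespace SahiSlot

/-! ### Linearity in the pinned slot: the first-point form -/

section FirstPoint

variable {d n : ℕ} {X : Type*}

/-- Composing a `Fin.cons` family of slot functions with a map of the slot cube. [folklore] -/
theorem cons_comp {n' : ℕ} (F : Q d n → ℝ) (g : Fin n' → Q d n → ℝ) (φ : Q d n → Q d n) :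
    (fun i => (Fin.cons F g : Fin (n' + 1) → Q d n → ℝ) i ∘ φ) = (Fin.cons (F ∘ φ) (fun i => g i ∘ φ) : Fin (n' + 1) → Q d n → ℝ) := by
  funext i
  refine Fin.cases ?_ (fun j => ?_) i
  · rfl
  · rfl

/-- The diagonal form is additive over a finite sum in slot `0`. [this work] -/
theorem diagForm_cons_sum {N : ℕ} (s : Finset X) (f : X → Q d (N + 1) → ℝ) (g : Fin N → Q d (N + 1) → ℝ) :
    diagForm d (N + 1) (Fin.cons (∑ x ∈ s, f x) g : Fin (N + 1) → Q d (N + 1) → ℝ) =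
      ∑ x ∈ s, diagForm d (N + 1) (Fin.cons (f x) g : Fin (N + 1) → Q d (N + 1) → ℝ) := by
  unfold diagForm
  rw [sum_comm]
  refine sum_congr rfl fun σ _ => ?_
  rw [← mul_sum]
  congr 1
  rw [Fin.prod_univ_succ]
  simp only [Fin.cons_zero, Fin.cons_succ, Finset.sum_apply, sum_mul]
  refine sum_congr rfl fun x _ => ?_
  rw [Fin.prod_univ_succ]
  simp only [Fin.cons_zero, Fin.cons_succ]

/-- The pattern functional is additive over a finite sum in slot `0`. [this work] -/
theorem patternForm_cons_sum {N : ℕ} (s : Finset X) (f : X → Q d (N + 1) → ℝ) (g : Fin N → Q d (N + 1) → ℝ) :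
    patternForm d (N + 1) (Fin.cons (∑ x ∈ s, f x) g : Fin (N + 1) → Q d (N + 1) → ℝ) =
      ∑ x ∈ s, patternForm d (N + 1) (Fin.cons (f x) g : Fin (N + 1) → Q d (N + 1) → ℝ) := by
  unfold patternForm
  rw [sum_comm]
  refine sum_congr rfl fun τ _ => ?_
  rw [cons_comp]
  have hs : (∑ x ∈ s, f x) ∘ act τ = ∑ x ∈ s, (f x ∘ act τ) := by
    funext q
    simp only [comp_apply, Finset.sum_apply]
  rw [hs, diagForm_cons_sum]
  refine sum_congr rfl fun x _ => ?_
  rw [cons_comp]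

/-- An indicator is the sum of the point indicators. [folklore] -/
theorem setInd_eq_sum_setInd_singleton [DecidableEq X] (A : Finset X) : setInd A = ∑ m ∈ A, setInd {m} := by
  funext q
  simp only [Finset.sum_apply, setInd_apply, mem_singleton]
  rw [sum_ite_eq]

/-- **First-point form**: the kernel with indicator slots is the sum over the points `m` of the first set of the kernel PINNED at `m`
(the "charge" of the remaining family at `m`). [this work] -/
theorem patternForm_cons_setInd_eq_sum_pinned {N : ℕ} (a₀ : Finset (Q d (N + 1))) (a : Fin N → Finset (Q d (N + 1))) :
    patternForm d (N + 1) (Fin.cons (setInd a₀) (fun i => setInd (a i)) : Fin (N + 1) → Q d (N + 1) → ℝ) =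
      ∑ m ∈ a₀, patternForm d (N + 1) (Fin.cons (setInd {m}) (fun i => setInd (a i)) : Fin (N + 1) → Q d (N + 1) → ℝ) := by
  rw [setInd_eq_sum_setInd_singleton, patternForm_cons_sum]

end FirstPoint

/-! ### Products over the points regrouped by cycles; signs -/

section CycleProducts

variable {n : ℕ}

/-- `Π_i f i = Π_{cycles c} Π_{i ∈ c} f i`. [folklore] -/
theorem prod_univ_eq_prod_orbits (ρ : Perm (Fin n)) (f : Fin n → ℝ) : ∏ i, f i = ∏ c ∈ orbits ρ, ∏ i ∈ c, f i := by
  rw [← prod_fiberwise_of_maps_to (g := orbit ρ) (t := orbits ρ) (fun i _ => orbit_mem_orbits ρ i)]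
  exact prod_congr rfl fun c hc => by rw [filter_orbit_eq_self hc]

/-- `Π_{i ∉ cycle of e} f i = Π_{cycles c ≠ cycle of e} Π_{i ∈ c} f i`. [folklore] -/
theorem prod_sdiff_orbit_eq (ρ : Perm (Fin n)) (e : Fin n) (f : Fin n → ℝ) :
    ∏ i ∈ univ \ orbit ρ e, f i = ∏ c ∈ (orbits ρ).erase (orbit ρ e), ∏ i ∈ c, f i := by
  rw [← prod_fiberwise_of_maps_to (s := univ \ orbit ρ e) (g := orbit ρ) (t := (orbits ρ).erase (orbit ρ e)) ?_]
  · refine prod_congr rfl fun c hc => prod_congr ?_ fun _ _ => rfl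
    have hc' : c ∈ orbits ρ := mem_of_mem_erase hc
    ext i
    simp only [mem_filter, mem_sdiff, mem_univ, true_and]
    constructor
    · rintro ⟨-, rfl⟩
      exact self_mem_orbit ρ i
    · intro hi
      have h1 : orbit ρ i = c := by
        have := filter_orbit_eq_self hc'
        rw [← this] at hi
        exact (mem_filter.1 hi).2
      refine ⟨fun hie => ?_, h1⟩
      exact (mem_erase.1 hc).1 ((orbit_eq_orbit_of_sameCycle (mem_orbit.1 hie)).trans h1).symm
  · intro i hi
    rw [mem_sdiff] at hi
    refine mem_erase.2 ⟨fun h => hi.2 ?_, orbit_mem_orbits ρ i⟩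
    rw [← h]
    exact self_mem_orbit ρ i

/-- On a cycle, `rep` is the least element of that cycle. [this work] -/
theorem rep_eq_min'_of_mem {ρ : Perm (Fin n)} {c : Finset (Fin n)} (hc : c ∈ orbits ρ) {i : Fin n} (hi : i ∈ c) (h : c.Nonempty) :
    rep ρ i = c.min' h := by
  obtain ⟨y, rfl⟩ := exists_eq_orbit_of_mem_orbits hc
  have hio : orbit ρ i = orbit ρ y := (orbit_eq_orbit_of_sameCycle (mem_orbit.1 hi)).symm
  refine rep_eq_of_mem_of_le ?_ ?_
  · rw [hio]; exact min'_mem _ _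
  · intro z hz
    rw [hio] at hz
    exact min'_le _ _ hz

/-- `(−1)^{C−1} Π_{c} w c = −Π_c (−w c)` for a permutation with `C ≥ 1` cycles. [folklore] -/
theorem neg_one_pow_mul_prod_orbits (ρ : Perm (Fin (n + 1))) (w : Finset (Fin (n + 1)) → ℝ) :
    (-1 : ℝ) ^ ((orbits ρ).card - 1) * ∏ c ∈ orbits ρ, w c = -∏ c ∈ orbits ρ, (-w c) := by
  rw [prod_neg]
  obtain ⟨C, hC⟩ : ∃ C, (orbits ρ).card = C + 1 := ⟨_, (Nat.sub_add_cancel (card_orbits_pos' ρ)).symm⟩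
  rw [hC, Nat.add_sub_cancel, pow_succ]
  ring

/-- `(−1)^{C−1} Π_{c ≠ c_e} w c = Π_{c ≠ c_e} (−w c)`. [folklore] -/
theorem neg_one_pow_mul_prod_erase (ρ : Perm (Fin (n + 1))) (e : Fin (n + 1)) (w : Finset (Fin (n + 1)) → ℝ) :
    (-1 : ℝ) ^ ((orbits ρ).card - 1) * ∏ c ∈ (orbits ρ).erase (orbit ρ e), w c = ∏ c ∈ (orbits ρ).erase (orbit ρ e), (-w c) := by
  rw [prod_neg, card_erase_of_mem (orbit_mem_orbits ρ e)]

end CycleProducts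

/-! ### The top-cell identity -/

section TopCell

variable {d N : ℕ}

/-- **TOP-CELL IDENTITY** (every order `N+2 ≥ 2`, every dimension `d`): at a point `m` of the meet of the family `a`, the pinned kernel is
`Σ_{τ'} Σ_{ρ} Π_{c ∈ cycles ρ} (1 − Π_{i ∈ c} [ι_m(τ'·diag(rep ρ i)) ∈ a_i])` — a sum of products of numbers in `{0,1}`. [this work] -/
theorem pinned_eq_topCell (a : Fin (N + 1) → Finset (Q d (N + 2))) {m : Q d (N + 2)} (hm : ∀ i, m ∈ a i) :
    patternForm d (N + 2) (Fin.cons (setInd {m}) (fun i => setInd (a i)) : Fin (N + 2) → Q d (N + 2) → ℝ) =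
      ∑ τ' : Fin d → Perm (Fin (N + 1)), ∑ ρ : Perm (Fin (N + 1)), ∏ c ∈ orbits ρ,
        (1 - ∏ i ∈ c, setInd (a i) (fun ax => (m ax).succAbove (act τ' (diag (rep ρ i)) ax))) := by
  unfold patternForm
  rw [sum_lperm_eq_sum_point_link (fun τ => diagForm d (N + 2) (fun i =>
    (Fin.cons (setInd {m}) (fun i => setInd (a i)) : Fin (N + 2) → Q d (N + 2) → ℝ) i ∘ act τ))]
  -- the insertion recursion at each extended tuple
  have key : ∀ (m' : Q d (N + 2)) (τ' : Fin d → Perm (Fin (N + 1))),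
      diagForm d (N + 2) (fun i => (Fin.cons (setInd {m}) (fun i => setInd (a i)) : Fin (N + 2) → Q d (N + 2) → ℝ) i ∘
        act (fun ax => (finSuccEquiv' (0 : Fin (N + 2))).trans ((Equiv.optionCongr (τ' ax)).trans (finSuccEquiv' (m' ax)).symm))) =
      (if m' = m then 1 else 0) * ∑ ρ : Perm (Fin (N + 1)), (-1 : ℝ) ^ ((orbits ρ).card - 1) *
        ((∑ e : Fin (N + 1), (∏ i ∈ orbit ρ e, setInd (a i) m') *
            ∏ i ∈ univ \ orbit ρ e, setInd (a i) (fun ax => (m' ax).succAbove (act τ' (diag (rep ρ i)) ax)))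
          - ∏ i : Fin (N + 1), setInd (a i) (fun ax => (m' ax).succAbove (act τ' (diag (rep ρ i)) ax))) := by
    intro m' τ'
    rw [diagForm_succ_succ]
    simp only [comp_apply, Fin.cons_zero, Fin.cons_succ, act_ext_diag_zero, act_ext_diag_succ, setInd_apply,
      mem_singleton]
  simp only [key, ite_mul, one_mul, zero_mul]
  rw [sum_comm, Finset.sum_congr rfl fun τ' _ => Finset.sum_ite_eq' univ m _]
  simp only [mem_univ, if_true]
  refine sum_congr rfl fun τ' _ => ?_
  -- at `m' = m`: the cycle receiving `0` contributes `1`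
  have hone : ∀ (ρ : Perm (Fin (N + 1))) (e : Fin (N + 1)), ∏ i ∈ orbit ρ e, setInd (a i) m = 1 := fun ρ e =>
    prod_eq_one fun i _ => by rw [setInd_apply, if_pos (hm i)]
  simp only [hone, one_mul]
  -- pass to cycle weights
  set Y : Fin (N + 1) → Fin (N + 1) → ℝ := fun i j => setInd (a i) (fun ax => (m ax).succAbove (act τ' (diag j) ax)) with hY
  let ω : Finset (Fin (N + 1)) → ℝ := fun c => if h : c.Nonempty then -∏ i ∈ c, Y i (c.min' h) else 0
  have hω : ∀ (ρ : Perm (Fin (N + 1))), ∀ c ∈ orbits ρ, -∏ i ∈ c, Y i (rep ρ i) = ω c := by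
    intro ρ c hc
    obtain ⟨y, hy⟩ := exists_eq_orbit_of_mem_orbits hc
    have hne : c.Nonempty := ⟨y, hy ▸ self_mem_orbit ρ y⟩
    simp only [ω, dif_pos hne]
    congr 1
    exact prod_congr rfl fun i hi => by rw [rep_eq_min'_of_mem hc hi hne]
  have hω' : ∀ (ρ : Perm (Fin (N + 1))), ∀ c ∈ orbits ρ, 1 - ∏ i ∈ c, Y i (rep ρ i) = 1 + ω c := by
    intro ρ c hc
    rw [← hω ρ c hc]
    ring
  calc ∑ ρ : Perm (Fin (N + 1)), (-1 : ℝ) ^ ((orbits ρ).card - 1) *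
        ((∑ e : Fin (N + 1), ∏ i ∈ univ \ orbit ρ e, Y i (rep ρ i)) - ∏ i : Fin (N + 1), Y i (rep ρ i))
      = ∑ ρ : Perm (Fin (N + 1)), ∑ e : Fin (N + 1), ∏ c ∈ (orbits ρ).erase (orbit ρ e), ω c
          + ∑ ρ : Perm (Fin (N + 1)), ∏ c ∈ orbits ρ, ω c := by
        rw [← sum_add_distrib]
        refine sum_congr rfl fun ρ _ => ?_
        rw [mul_sub, mul_sum, prod_univ_eq_prod_orbits ρ, neg_one_pow_mul_prod_orbits,
          prod_congr rfl (hω ρ)]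
        simp only [prod_sdiff_orbit_eq ρ, neg_one_pow_mul_prod_erase]
        rw [sum_congr rfl fun e _ => prod_congr rfl fun c hc => hω ρ c (mem_of_mem_erase hc)]
        ring
    _ = ∑ ρ : Perm (Fin (N + 1)), ∏ c ∈ orbits ρ, (1 + ω c) := sum_pointed_add_sum_prod ω
    _ = ∑ ρ : Perm (Fin (N + 1)), ∏ c ∈ orbits ρ, (1 - ∏ i ∈ c, Y i (rep ρ i)) :=
        sum_congr rfl fun ρ _ => prod_congr rfl fun c hc => (hω' ρ c hc).symm

end TopCell

/-! ### Nonnegativity and monotonicity on the meet -/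

section Monotone

variable {d N : ℕ}

/-- `succAbove` is antitone in the pivot: raising the pivot lowers the embedded point. [folklore] -/
theorem succAbove_anti_left {n : ℕ} {p p' : Fin (n + 1)} (hpp' : p ≤ p') (x : Fin n) : p'.succAbove x ≤ p.succAbove x := by
  by_cases hx : Fin.castSucc x < p
  · rw [Fin.succAbove_of_castSucc_lt _ _ hx, Fin.succAbove_of_castSucc_lt _ _ (lt_of_lt_of_le hx hpp')]
  · rw [Fin.succAbove_of_le_castSucc _ _ (not_lt.1 hx)]
    by_cases hx' : Fin.castSucc x < p'
    · rw [Fin.succAbove_of_castSucc_lt _ _ hx']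
      exact le_of_lt Fin.castSucc_lt_succ
    · rw [Fin.succAbove_of_le_castSucc _ _ (not_lt.1 hx')]

/-- A product of indicator values lies in `[0,1]`: nonnegative … [folklore] -/
theorem prod_setInd_nonneg {X : Type*} [DecidableEq X] {ι : Type*} (s : Finset ι) (A : ι → Finset X) (x : ι → X) :
    0 ≤ ∏ i ∈ s, setInd (A i) (x i) :=
  prod_nonneg fun _ _ => setInd_nonneg _ _

/-- … and at most `1`. [folklore] -/
theorem prod_setInd_le_one {X : Type*} [DecidableEq X] {ι : Type*} (s : Finset ι) (A : ι → Finset X) (x : ι → X) :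
    ∏ i ∈ s, setInd (A i) (x i) ≤ 1 :=
  prod_le_one (fun _ _ => setInd_nonneg _ _) fun _ _ => by
    rw [setInd_apply]; split_ifs <;> norm_num

/-- **LEMMA R AT EVERY ORDER**: at a point of the meet, the charge is nonnegative — for arbitrary sets `a_i`. [this work] -/
theorem pinned_nonneg_of_mem (a : Fin (N + 1) → Finset (Q d (N + 2))) {m : Q d (N + 2)} (hm : ∀ i, m ∈ a i) :
    0 ≤ patternForm d (N + 2) (Fin.cons (setInd {m}) (fun i => setInd (a i)) : Fin (N + 2) → Q d (N + 2) → ℝ) := by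
  rw [pinned_eq_topCell a hm]
  refine sum_nonneg fun τ' _ => sum_nonneg fun ρ _ => prod_nonneg fun c _ => ?_
  exact sub_nonneg.2 (prod_setInd_le_one _ _ _)

/-- **CHARGE MONOTONICITY AT EVERY ORDER**: for up-sets `a_i`, the charge is order-preserving on the meet `⋂ a_i`. [this work] -/
theorem pinned_mono_of_mem (a : Fin (N + 1) → Finset (Q d (N + 2))) (ha : ∀ i, IsUpperSet ((a i : Finset (Q d (N + 2))) : Set (Q d (N + 2))))
    {m m' : Q d (N + 2)} (hmm' : m ≤ m') (hm : ∀ i, m ∈ a i) :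
    patternForm d (N + 2) (Fin.cons (setInd {m}) (fun i => setInd (a i)) : Fin (N + 2) → Q d (N + 2) → ℝ) ≤
      patternForm d (N + 2) (Fin.cons (setInd {m'}) (fun i => setInd (a i)) : Fin (N + 2) → Q d (N + 2) → ℝ) := by
  have hm' : ∀ i, m' ∈ a i := fun i => ha i hmm' (hm i)
  rw [pinned_eq_topCell a hm, pinned_eq_topCell a hm']
  refine sum_le_sum fun τ' _ => sum_le_sum fun ρ _ => ?_
  refine prod_le_prod (fun _ _ => sub_nonneg.2 (prod_setInd_le_one _ _ _)) fun c _ => ?_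
  -- each factor grows: the traces shrink
  refine sub_le_sub_left (prod_le_prod (fun _ _ => setInd_nonneg _ _) fun i _ => ?_) 1
  rw [setInd_apply, setInd_apply]
  split_ifs with h1 h2
  · exact le_rfl
  · exact absurd (ha i (fun ax => succAbove_anti_left (hmm' ax) _) h1) h2
  · norm_num
  · exact le_rfl

end Monotone

end SahiSlot

end Summit.CriticalPhenomena.PercolationContinuityZ3.Theorems
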